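import Mathlib
import HarnessLib
import Summits.SmoothPoincare4.SmoothPoincare4.Theses.CommonDualRelay

/-!
# gen-24 by-product (fwd-ladder SblfExists → StepTwo line `fibred_regluing`)

First lemma of the crux idea `light-bulb-regluing` on stmt-SmoothPoincare4-18529:
the ONE-PAIR light-bulb surgery principle, typed over route CommonDualRelay's vocabulary
(`FramedSphereFamily`, `IsGeometricallyDual`, `IsSurgery`) and DERIVED from its two items
`GabaiSystemsLightBulb` (stmt-15792, Gabai2020 Thm 10.1 / Thm 1.2) and
`SurgeryImageInvariance` (stmt-15793).  The geometric content of the idea — that the middle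
level of the Baykur–Sunukjian round-2-handle cobordism S⁴ ~ X_τ of a primitive fibred torus
regluing realises these hypotheses with σ = (handle disc) ∪ (framed compressing disc of the
parallel lower torus) ♮ (meridian disc of the lower fibre) — is recorded in C-lb.md.
-/

namespace Summit.SmoothPoincare4.SmoothPoincare4.Cruxes.StepTwo.LightBulbRegluing

open scoped Manifold ContDiff Topology
open Literature.Topology.FourManifolds

/-- ONE-PAIR LIGHT-BULB SURGERY PRINCIPLE.  In a closed simply connected smooth oriented
4-manifold `N`, let `A`, `C` be framed embedded 2-spheres (one-member framed families) that are
homotopic and admit a COMMON geometric dual framed sphere `σ` (|σ ⋔ A| = 1 = |σ ⋔ C|, σ framed,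
i.e. square 0).  Then any surgery of `N` along `A` is diffeomorphic to any surgery of `N` along
`C`.  (Gabai2020 Thm 1.2 + surgery bookkeeping; the square-0 condition on σ is necessary:
Schwartz arXiv:2012.05939 Main Theorem, Klug–Miller.) -/
def LightBulbSurgeryOnePair : Prop :=
  ∀ (N : Type) [TopologicalSpace N] [T2Space N] [SecondCountableTopology N]
    [ChartedSpace (EuclideanSpace ℝ (Fin 4)) N] [IsManifold (𝓡 4) ∞ N] [CompactSpace N]
    [SimplyConnectedSpace N]
    (oN : SmoothOrientation (𝓡 4) N)
    (oS : SmoothOrientation (𝓡 2) (Metric.sphere (0 : EuclideanSpace ℝ (Fin 3)) 1))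
    (A C σ : FramedSphereFamily (𝓡 4) N (Fin 1) 2 2),
    IsGeometricallyDual (𝓡 2) (𝓡 2) (𝓡 4) two_add_two_eq_four oS oS oN σ.sphere A.sphere →
    IsGeometricallyDual (𝓡 2) (𝓡 2) (𝓡 4) two_add_two_eq_four oS oS oN σ.sphere C.sphere →
    (∀ i, (⟨A.sphere i, A.continuous_sphere i⟩ :
        C(↥(Metric.sphere (0 : EuclideanSpace ℝ (Fin 3)) 1), N)).Homotopic
        ⟨C.sphere i, C.continuous_sphere i⟩) →
    ∀ (X : Type) [TopologicalSpace X] [T2Space X] [SecondCountableTopology X]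
      [ChartedSpace (EuclideanSpace ℝ (Fin 4)) X] [IsManifold (𝓡 4) ∞ X]
      (Y : Type) [TopologicalSpace Y] [T2Space Y] [SecondCountableTopology Y]
      [ChartedSpace (EuclideanSpace ℝ (Fin 4)) Y] [IsManifold (𝓡 4) ∞ Y],
      A.IsSurgery (𝓡 4) X → C.IsSurgery (𝓡 4) Y → Nonempty (X ≃ₘ⟮𝓡 4, 𝓡 4⟯ Y)

/-- The principle is the k = 1 instance of CommonDualRelay's two FACT-GATE items. -/
theorem lightBulbSurgeryOnePair_of
    (hLB : Summit.SmoothPoincare4.SmoothPoincare4.Theses.CommonDualRelay.GabaiSystemsLightBulb)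
    (hSI : Summit.SmoothPoincare4.SmoothPoincare4.Theses.CommonDualRelay.SurgeryImageInvariance) :
    LightBulbSurgeryOnePair := by
  intro N _ _ _ _ _ _ _ oN oS A C σ hA hC hhom X _ _ _ _ _ Y _ _ _ _ _ hX hY
  obtain ⟨φ, hφ⟩ := hLB N oN oS 1 A C σ hA hC hhom
  exact hSI N φ 1 A C hφ X Y hX hY

end Summit.SmoothPoincare4.SmoothPoincare4.Cruxes.StepTwo.LightBulbRegluing
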